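import Summits.Ventures.PercRepro.ExcessOneNonTightening
import Summits.Ventures.PercRepro.ExcessOneSingleton

/-!
# Theorem (TT): an excess-one twin-free family has at least two tight traces

**Theorem** (proofs/MINE1-theoremS.md Addendum 30, Conjecture (TT) of Addendum 29 without its side
conditions). Let `F` be a family of subsets of a finite set `u` with `|F \\ F| = |F| + 1` and no
two twins in `u`. Then at least two elements `a ∈ u` have `proj a F` tight
(`exists_two_tight_proj`).

*Proof.* Strong induction on the support `u`. Every family on at most one element is tight
(`card_diffs_le_two_of_subset_card_le_one`), so `|u| ≥ 2`. If every trace is tight we are done.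
Otherwise take `a` with `proj a F` not tight: `a` is a non-tightening direction
(`exc(proj a F) = exc(F) = 1`), and by the induction hypothesis `proj a F` — a twin-free
excess-one family on `u.erase a` — has two tight traces at `b ≠ c`. **The lifting lemma**
(`tight_proj_of_tight_proj_proj'`) carries them up to `F`: for a nontrivial `a` Theorem (SD)
(`singleton_mem_diffs_of_card_diffs_le`) gives `{a} ∈ F \\ F`, hence a nonempty partner family,
and Theorem (NT) (`tight_proj_of_tight_proj_proj`) applies; a trivial `a` (in no member, or in
every member) changes nothing (`proj_eq_self_of_forall_notMem`, `tight_proj_iff_of_forall_mem`).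
-/

namespace PercRepro.MSTight

open Finset
open scoped FinsetFamily

variable {α : Type*} [DecidableEq α]

/-- Projecting along an element that lies in no member does nothing. -/
theorem proj_eq_self_of_forall_notMem {a : α} {F : Finset (Finset α)} (h : ∀ t ∈ F, a ∉ t) :
    proj a F = F := by
  ext t
  simp only [mem_proj]
  constructor
  · rintro ⟨s, hs, rfl⟩
    rwa [erase_eq_of_notMem (h s hs)]
  · intro ht
    exact ⟨t, ht, erase_eq_of_notMem (h t ht)⟩

/-- Projecting along an element that lies in every member preserves the member count. -/
theorem card_proj_of_forall_mem {a : α} {G : Finset (Finset α)} (h : ∀ t ∈ G, a ∈ t) :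
    (proj a G).card = G.card := by
  unfold proj
  refine card_image_of_injOn fun t ht s hs hts => ?_
  have hts' : t.erase a = s.erase a := hts
  rw [← insert_erase (h t ht), ← insert_erase (h s hs), hts']

/-- Projecting along an element that lies in every member preserves tightness in both
directions: the differences avoid the element, so the difference family is unchanged. -/
theorem tight_proj_iff_of_forall_mem {a : α} {G : Finset (Finset α)} (h : ∀ t ∈ G, a ∈ t) :
    Tight (proj a G) ↔ Tight G := by
  have hD : proj a G \\ proj a G = G \\ G := by
    rw [diffs_proj_eq_proj_diffs]
    refine proj_eq_self_of_forall_notMem fun d hd => ?_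
    obtain ⟨t, _, s, hs, rfl⟩ := mem_diffs.1 hd
    exact fun had => (mem_sdiff.1 had).2 (h s hs)
  unfold Tight
  rw [hD, card_proj_of_forall_mem h]

/-- A family whose members lie in a set of at most one element has at most two differences. -/
theorem card_diffs_le_two_of_subset_card_le_one {u : Finset α} (hu : u.card ≤ 1)
    {F : Finset (Finset α)} (hF : ∀ t ∈ F, t ⊆ u) : (F \\ F).card ≤ 2 := by
  have h1 : F \\ F ⊆ u.powerset := by
    intro d hd
    obtain ⟨t, ht, s, _, rfl⟩ := mem_diffs.1 hd
    exact mem_powerset.2 (sdiff_subset.trans (hF t ht))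
  have h2 := card_le_card h1
  rw [card_powerset] at h2
  have h3 : 2 ^ u.card ≤ 2 ^ 1 := Nat.pow_le_pow_right (by norm_num) hu
  omega

/-- An excess-one family needs at least two elements. -/
theorem one_lt_card_of_card_diffs_eq {u : Finset α} {F : Finset (Finset α)} (hsub : ∀ t ∈ F, t ⊆ u)
    (hF : (F \\ F).card = F.card + 1) : 1 < u.card := by
  by_contra hu
  have hu' : u.card ≤ 1 := by omega
  have h1 := card_diffs_le_two_of_subset_card_le_one hu' hsub
  have h2 := card_diffs_le (s := F) (t := F)
  have h3 : F.card ≤ 1 := by omega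
  interval_cases hc : F.card <;> omega

variable [Fintype α]

/-- **The lifting lemma for excess-one families.** If `proj a F` is not tight, `a` has no twin among
the elements of the members, and `proj b (proj a F)` is tight, then `proj b F` is tight. -/
theorem tight_proj_of_tight_proj_proj' {F : Finset (Finset α)} (hF : (F \\ F).card = F.card + 1)
    {a : α} (htw : ∀ b, (∃ t ∈ F, b ∈ t) → Twin F a b → b = a) (hna : ¬ Tight (proj a F))
    {b : α} (hba : b ≠ a) (hT : Tight (proj b (proj a F))) : Tight (proj b F) := by
  by_cases hin : ∃ t ∈ F, a ∈ t
  · by_cases hout : ∃ t ∈ F, a ∉ t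
    · -- `a` is nontrivial: Theorem (SD) gives `{a} ∈ F \\ F`, so the partner family is nonempty
      obtain ⟨t₀, ht₀, hat₀⟩ := hin
      have htw' : ∀ c, Twin F a c → c = a := fun c hc =>
        htw c ⟨t₀, ht₀, (hc t₀ ht₀).1 hat₀⟩ hc
      have hsing : ({a} : Finset α) ∈ F \\ F :=
        singleton_mem_diffs_of_card_diffs_le (le_of_eq hF) htw' ⟨t₀, ht₀, hat₀⟩ hout
      have hempty : (∅ : Finset α) ∈ F \\ F := mem_diffs.2 ⟨t₀, ht₀, t₀, ht₀, by simp⟩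
      have hXY : (∅ : Finset α) ∈ diffsX a F ∩ diffsY a F :=
        mem_inter.2 ⟨mem_diffsX_iff.2 ⟨hempty, notMem_empty a⟩,
          mem_diffsY_iff.2 ⟨notMem_empty a, by simpa using hsing⟩⟩
      -- `a` is non-tightening: `exc(proj a F) = 1`
      have hε : (diffsX a F ∩ diffsY a F).card = (partner a F).card := by
        have h0 := card_diffs_eq_card_diffs_proj_add a F
        have h1 := card_diffs_proj_add_card_partner_le a F
        have h2 := card_eq_card_proj_add_card_partner a F
        have h3 : (proj a F).card ≤ (proj a F \\ proj a F).card := card_le_card_diffs _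
        have h4 : (proj a F \\ proj a F).card ≠ (proj a F).card := hna
        omega
      have hK : (partner a F).Nonempty := by
        rw [← card_pos, ← hε]
        exact card_pos.2 ⟨∅, hXY⟩
      exact tight_proj_of_tight_proj_proj hε hK hba hT
    · -- `a` lies in every member
      have hout' : ∀ t ∈ F, a ∈ t := fun t ht => by_contra fun h => hout ⟨t, ht, h⟩
      rw [proj_proj_comm] at hT
      refine (tight_proj_iff_of_forall_mem fun t ht => ?_).1 hT
      obtain ⟨s, hs, rfl⟩ := mem_proj.1 ht
      exact mem_erase.2 ⟨hba.symm, hout' s hs⟩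
  · -- `a` lies in no member
    have hin' : ∀ t ∈ F, a ∉ t := fun t ht h => hin ⟨t, ht, h⟩
    rwa [proj_eq_self_of_forall_notMem hin'] at hT

/-- **Theorem (TT)**, induction form: a family on the support `u` with `|F \\ F| = |F| + 1` and no two
twins in `u` has two distinct elements of `u` with tight traces. -/
theorem exists_two_tight_proj_aux (u : Finset α) :
    ∀ F : Finset (Finset α), (∀ t ∈ F, t ⊆ u) → (∀ a ∈ u, ∀ b ∈ u, Twin F a b → a = b) →
      (F \\ F).card = F.card + 1 →
        ∃ a ∈ u, ∃ b ∈ u, a ≠ b ∧ Tight (proj a F) ∧ Tight (proj b F) := by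
  induction u using Finset.strongInduction with
  | H u ih =>
    intro F hsub htw hF
    by_cases hall : ∀ a ∈ u, Tight (proj a F)
    · obtain ⟨a, ha, b, hb, hab⟩ := one_lt_card.1 (one_lt_card_of_card_diffs_eq hsub hF)
      exact ⟨a, ha, b, hb, hab, hall a ha, hall b hb⟩
    · obtain ⟨a, ha, hna⟩ : ∃ a ∈ u, ¬ Tight (proj a F) := by
        by_contra h
        exact hall fun a ha => by_contra fun h' => h ⟨a, ha, h'⟩
      -- the projection along `a` is an excess-one twin-free family on `u.erase a`
      have hsub' : ∀ t ∈ proj a F, t ⊆ u.erase a := by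
        intro t ht
        obtain ⟨s, hs, rfl⟩ := mem_proj.1 ht
        exact erase_subset_erase a (hsub s hs)
      have htw' : ∀ b ∈ u.erase a, ∀ c ∈ u.erase a, Twin (proj a F) b c → b = c := by
        intro b hb c hc hbc
        refine htw b (mem_of_mem_erase hb) c (mem_of_mem_erase hc) fun t ht => ?_
        have := hbc (t.erase a) (mem_proj.2 ⟨t, ht, rfl⟩)
        simp only [mem_erase, ne_eq] at this hb hc
        tauto
      have hF' : (proj a F \\ proj a F).card = (proj a F).card + 1 := by
        have h1 := card_diffs_proj_add_card_partner_le a F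
        have h2 := card_eq_card_proj_add_card_partner a F
        have h3 : (proj a F).card ≤ (proj a F \\ proj a F).card := card_le_card_diffs _
        have h4 : (proj a F \\ proj a F).card ≠ (proj a F).card := hna
        omega
      obtain ⟨b, hb, c, hc, hbc, hTb, hTc⟩ := ih (u.erase a) (erase_ssubset ha) (proj a F) hsub' htw' hF'
      have htwa : ∀ d, (∃ t ∈ F, d ∈ t) → Twin F a d → d = a := by
        rintro d ⟨t, ht, hdt⟩ hd
        exact (htw a ha d ((hsub t ht) hdt) hd).symm
      refine ⟨b, mem_of_mem_erase hb, c, mem_of_mem_erase hc, hbc, ?_, ?_⟩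
      · exact tight_proj_of_tight_proj_proj' hF htwa hna (ne_of_mem_erase hb) hTb
      · exact tight_proj_of_tight_proj_proj' hF htwa hna (ne_of_mem_erase hc) hTc

/-- **Theorem (TT).** A twin-free family with `|F \\ F| = |F| + 1` has two distinct elements with
tight traces. -/
theorem exists_two_tight_proj {F : Finset (Finset α)} (htw : ∀ a b, Twin F a b → a = b)
    (hF : (F \\ F).card = F.card + 1) :
    ∃ a b, a ≠ b ∧ Tight (proj a F) ∧ Tight (proj b F) := by
  obtain ⟨a, _, b, _, hab, ha, hb⟩ :=
    exists_two_tight_proj_aux Finset.univ F (fun t _ => subset_univ t)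
      (fun a _ b _ h => htw a b h) hF
  exact ⟨a, b, hab, ha, hb⟩

end PercRepro.MSTight
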